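import Mathlib
import HarnessLib
import Summits.HubbardSuperconductivity.HubbardSuperconductivity.Theorems.KLProgrammeKLRegimeOverlapWtFlowDeepVol
import Summits.HubbardSuperconductivity.HubbardSuperconductivity.Theorems.KLProgrammeKLRegimeTwoVolumeLipJumpDefs
import Summits.HubbardSuperconductivity.HubbardSuperconductivity.Theorems.KLProgrammeKLRegimeEngineTowerModelDefsRate

/-!
# Route `KLProgramme` — crux K3 ENGINE (stmt-HubbardSuperconductivity-20437 `KLRegimeEngineV17F2`), stub (e) proof-input «(e)-D-ROWS», named row N5 DISCHARGED IN THE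
# DEEP WINDOW: the `klScaleWt`-weighted rows AND columns of the jump matrices `klJump V … K_n J′ k` on ANY lattice `V ≥ L₃` at the coarse flow frame, with the
# envelope `≤ C_J·2^{J′−k}`
# (seat hubbard-kl-k3c4-p1 g25, VL lane; `--supports` 20437; DROWS-SCOPE-g25 §13.6/§13.8 N5; suppliers: E1's lattice-decoupled overlap rows
#  `TorusFourierL2.overlapWt_jump_sums_klEng_flow_deep_vol` (rows `≤ 81·C·M/β`) and `…overlapWt_colSum_klEng_flow_deep_vol` (full columns `≤ 81·2^{J′−k}·C·M/β`))

The two-volume Lipschitz tower (`…TwoVolumeLipLawOfRowsBase1.klLipBornDiffSup_le_law_of_rows_base1`) names, per block, the `klScaleWt (bL) M β j_r`-weighted row and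
column sums of the one-step transfer `klLipTransfer (bL) … d k = klJump (bL) … (dk) (dk−1)` and of the re-measurement jumps `klJump (bL) … (dk−1) (dk′)`, `1 ≤ k′ < k`,
`klJump (bL) … (dk−1) (d−1)`, with the envelope `cWJ k k′ ≤ C_J·2^{dk−1−dk′}`.  Since `klJump = ε•(E·S)` (`klJump_eq_smul`, `ε = β/(2M)`), E1's deep-window overlap rows on
the lattice `V` at the COARSE flow frame `K_n = klFlowFrameU L M β U μ n` give exactly this, at every weight rate `j_r ≥ J′` (`klScaleWt` decreases in the rate):
rows `≤ (81/2)·C`, columns `≤ (81/2)·2^{J′−k}·C`.  Deep window: `4^n·U ≤ 4^{2(k+1)+dd}` (the shallow blocks are the HE1free/SrcUV atoms' business, DROWS-SCOPE-g25 §13.8).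

* `norm_klJump_eq` — `‖klJump V … J′ k x y′‖ = ε·‖(E·S) x y′‖`;
* `klJump_towerRows_klEng_deep_vol` (g25 append) — the same keyed for the tower's jumps `(dk−1) ← J` (`J = dk′` or `d−1`);
* **`klJump_scaleWtRows_klEng_deep_vol`** — `∃ C_J > 0`, under the regime binders of the `_vol` suppliers: for `V ≥ L₃`, `k+1 ≤ J′ ≤ n`, the window, and `j_r ≥ J′`,
  both weighted sums of `klJump V M β μ K_n J′ k` are `≤ C_J·2^{J′−k}`.

Compositions of landed theorems; nothing about the model is asserted beyond them; nothing asserts the (D) rows, stub (e), VL, K3 or superconductivity.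
References: BGM 2006 §2.7 (2.71a), §2.8 (2.77), (2.82)–(2.83) [cite: BenfattoGiulianiMastropietro2006].
-/

noncomputable section

namespace Summit.HubbardSuperconductivity.HubbardSuperconductivity.Theorems.TwoVolumeLip

set_option linter.dupNamespace false -- summit = problem name (single-conjunct summit), D-0017

open Finset Literature.MathematicalPhysics.QuantumLattice GrassmannAlgebra Literature.Probability.LatticeModels
open Literature.MathematicalPhysics.QuantumLattice.FermiRG
open Summit.HubbardSuperconductivity.HubbardSuperconductivity.Theorems.KLRegimeSplit
open Summit.HubbardSuperconductivity.HubbardSuperconductivity.Theorems.KLProgrammeLegKernels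
open Summit.HubbardSuperconductivity.HubbardSuperconductivity.Theorems.DispersionFlow
open Summit.HubbardSuperconductivity.HubbardSuperconductivity.Theorems.EngineV8
open Summit.HubbardSuperconductivity.HubbardSuperconductivity.Theorems.TorusFourierL2

/-- `‖klJump V … J′ k x y′‖ = ε·‖(E·S) x y′‖` (`0 ≤ β`). -/
theorem norm_klJump_eq {V M : ℕ} [NeZero V] {β : ℝ} (hβ : 0 ≤ β) (μ : ℝ) (K : TrigPolyC4v) (J' k : ℕ)
    (x : SpaceTimeIdx V M × SectorLeg (sectorCount J')) (y' : SpaceTimeIdx V M × SectorLeg (sectorCount k)) :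
    ‖klJump V M β μ K J' k x y'‖ = imagTimeWeight β M *
      ‖(sectorAnalysisMatrix V M β (klAnisoFamily V M β μ K klE0 J') * sectorSubMatrix V M β (bgmFatMultiplier V M klE0 β (nambuXiCT V μ K) k)) x y'‖ := by
  rw [klJump_eq_smul, Matrix.smul_apply, smul_eq_mul, norm_mul, Complex.norm_real, Real.norm_of_nonneg (imagTimeWeight_nonneg hβ M)]

set_option maxHeartbeats 800000 in -- long binder list
/-- **N5 in the deep window**: `∃ C_J > 0` such that, under the regime binders of E1's lattice-decoupled overlap rows, for every lattice `V ≥ L₃`, jump `k+1 ≤ J′ ≤ n` in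
the deep window `4^n·U ≤ 4^{2(k+1)+dd}` and weight rate `j_r ≥ J′`, the `klScaleWt V M β j_r`-weighted ROW and COLUMN sums of `klJump V M β μ K_n J′ k` are both
`≤ C_J·2^{J′−k}`. [cite: BenfattoGiulianiMastropietro2006, §2.7 (2.71a), §2.8 (2.77), (2.82)-(2.83)] -/
theorem klJump_scaleWtRows_klEng_deep_vol (dd : ℕ) :
    ∃ CJ : ℝ, 0 < CJ ∧
      ∀ (G : GeoConsts) (P : SplitConsts) (R : RenConsts) (Q : EngConsts) (cc : ℝ), R.WF2 → 0 < cc → cc ≤ EngineV8.klEngC₃6 P R →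
      ∀ μ ∈ klWindowC, ∀ U : ℝ, 0 < U → U ≤ min (EngineV8.klEngU₀3 P R cc) (1 / (R.Gfr 3 + 1)) →
      ∀ β : ℝ, klBetaMin ≤ β → β ≤ Real.exp (cc / U ^ 2) →
      ∀ (L M : ℕ) [NeZero L] [NeZero M], EngineV8.klEngL₃ β U ≤ L → EngineV8.klEngM₃ β U L ≤ M →
      ∀ n : ℕ, 1 ≤ n → n ≤ nScales β + 1 →
        HistP klPredsV17F2 L M G P Q R β U μ 0 n → FrameOK R U (nScales β) μ (klFlowFrameU L M β U μ n) →
        ∀ (V : ℕ) [NeZero V], EngineV8.klEngL₃ β U ≤ V →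
        ∀ k J' : ℕ, k + 1 ≤ J' → J' ≤ n → (4 : ℝ) ^ n * U ≤ (4 : ℝ) ^ (2 * (k + 1) + dd) → ∀ jr : ℕ, J' ≤ jr →
        (∀ x : SpaceTimeIdx V M × SectorLeg (sectorCount J'),
          ∑ y', ‖klJump V M β μ (klFlowFrameU L M β U μ n) J' k x y'‖ *
            klScaleWt V M β jr {latticeLegPos (2 * (2 * M)) x, latticeLegPos (2 * (2 * M)) y'} ≤ CJ * (2 : ℝ) ^ (J' - k)) ∧
        (∀ y' : SpaceTimeIdx V M × SectorLeg (sectorCount k),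
          ∑ x, ‖klJump V M β μ (klFlowFrameU L M β U μ n) J' k x y'‖ *
            klScaleWt V M β jr {latticeLegPos (2 * (2 * M)) x, latticeLegPos (2 * (2 * M)) y'} ≤ CJ * (2 : ℝ) ^ (J' - k)) := by
  obtain ⟨C₁, hC₁, h₁⟩ := overlapWt_jump_sums_klEng_flow_deep_vol dd
  obtain ⟨C₂, hC₂, h₂⟩ := overlapWt_colSum_klEng_flow_deep_vol dd
  refine ⟨81 * (C₁ + C₂), by positivity, ?_⟩
  intro G P R Q cc hR2 hcc hcc6 μ hμ U hU hUle β hβmin hβc L M _ _ hL3 hM3 n hn1 hnN hhist hfr V _ hV3 k J' hJ hJn hnd jr hjr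
  have hβ : 0 < β := pos_of_klBetaMin_le hβmin
  have hM0 : (0 : ℝ) < M := Nat.cast_pos.2 (Nat.pos_of_ne_zero (NeZero.ne M))
  set K : TrigPolyC4v := klFlowFrameU L M β U μ n with hK
  obtain ⟨hrow, -, -⟩ := h₁ G P R Q cc hR2 hcc hcc6 μ hμ U hU hUle β hβmin hβc L M hL3 hM3 n hn1 hnN hhist hfr V hV3 k J' hJ hJn hnd
  have hcol := h₂ G P R Q cc hR2 hcc hcc6 μ hμ U hU hUle β hβmin hβc L M hL3 hM3 n hn1 hnN hhist hfr V hV3 k J' hJ hJn hnd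
  have hε : imagTimeWeight β M * ((M : ℝ) / β) = 1 / 2 := by
    unfold imagTimeWeight; field_simp
  have hwt : ∀ S : Finset (ZMod (2 * (2 * M)) × TorusSite 2 V), klScaleWt V M β jr S ≤ klScaleWt V M β J' S := fun S => klScaleWt_le_of_le β hjr S
  have h2 : (1 : ℝ) ≤ (2 : ℝ) ^ (J' - k) := one_le_pow₀ (by norm_num)
  refine ⟨fun x => ?_, fun y' => ?_⟩
  · calc ∑ y', ‖klJump V M β μ K J' k x y'‖ * klScaleWt V M β jr {latticeLegPos (2 * (2 * M)) x, latticeLegPos (2 * (2 * M)) y'}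
        ≤ ∑ y', imagTimeWeight β M * (‖(sectorAnalysisMatrix V M β (klAnisoFamily V M β μ K klE0 J') *
            sectorSubMatrix V M β (bgmFatMultiplier V M klE0 β (nambuXiCT V μ K) k)) x y'‖ *
              klScaleWt V M β J' {latticeLegPos (2 * (2 * M)) x, latticeLegPos (2 * (2 * M)) y'}) :=
          sum_le_sum fun y' _ => by
            rw [norm_klJump_eq hβ.le, mul_assoc]
            exact mul_le_mul_of_nonneg_left (mul_le_mul_of_nonneg_left (hwt _) (norm_nonneg _)) (imagTimeWeight_nonneg hβ.le M)
      _ ≤ imagTimeWeight β M * (81 * C₁ * M / β) := by rw [← mul_sum]; exact mul_le_mul_of_nonneg_left (hrow x) (imagTimeWeight_nonneg hβ.le M)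
      _ = 81 * C₁ * (1 / 2) := by rw [← hε]; ring
      _ ≤ 81 * (C₁ + C₂) * (2 : ℝ) ^ (J' - k) := by nlinarith [hC₁, hC₂, h2]
  · calc ∑ x, ‖klJump V M β μ K J' k x y'‖ * klScaleWt V M β jr {latticeLegPos (2 * (2 * M)) x, latticeLegPos (2 * (2 * M)) y'}
        ≤ ∑ x, imagTimeWeight β M * (‖(sectorAnalysisMatrix V M β (klAnisoFamily V M β μ K klE0 J') *
            sectorSubMatrix V M β (bgmFatMultiplier V M klE0 β (nambuXiCT V μ K) k)) x y'‖ *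
              klScaleWt V M β J' {latticeLegPos (2 * (2 * M)) x, latticeLegPos (2 * (2 * M)) y'}) :=
          sum_le_sum fun x _ => by
            rw [norm_klJump_eq hβ.le, mul_assoc]
            exact mul_le_mul_of_nonneg_left (mul_le_mul_of_nonneg_left (hwt _) (norm_nonneg _)) (imagTimeWeight_nonneg hβ.le M)
      _ ≤ imagTimeWeight β M * (81 * (2 : ℝ) ^ (J' - k) * C₂ * M / β) := by
          rw [← mul_sum]; exact mul_le_mul_of_nonneg_left (hcol y') (imagTimeWeight_nonneg hβ.le M)
      _ = 81 * C₂ * (2 : ℝ) ^ (J' - k) * (1 / 2) := by rw [← hε]; ring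
      _ ≤ 81 * (C₁ + C₂) * (2 : ℝ) ^ (J' - k) := by nlinarith [hC₁, hC₂, h2]

set_option maxHeartbeats 800000 in -- long binder list
/-- **N5 for the tower's jumps** (corollary of `klJump_scaleWtRows_klEng_deep_vol`): at the fine lattice `V` and the coarse flow frame, for a block `k ≥ 1` (`2 ≤ dk`,
`dk ≤ n`) and an earlier block `k′ < k` with `1 ≤ dk′` in the deep window `4^n·U ≤ 4^{2(dk′+1)+dd}`, the `klScaleWt V M β j_r`-weighted rows and columns of the
re-measurement jump `klJump V … K_n (dk−1) (dk′)` are `≤ C_J·2^{dk−1−dk′}` for every rate `j_r ≥ dk−1` — the hypotheses `hrowJ/hcolJ/hcWenv` (and, at `dk′ := d−1`,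
`hrowJ1/hcolJ1/hcWJ1env`) of `…TwoVolumeLipLawOfRowsBase1.klLipBornDiffSup_le_law_of_rows_base1` at that pair of blocks. -/
theorem klJump_towerRows_klEng_deep_vol (dd : ℕ) :
    ∃ CJ : ℝ, 0 < CJ ∧
      ∀ (G : GeoConsts) (P : SplitConsts) (R : RenConsts) (Q : EngConsts) (cc : ℝ), R.WF2 → 0 < cc → cc ≤ EngineV8.klEngC₃6 P R →
      ∀ μ ∈ klWindowC, ∀ U : ℝ, 0 < U → U ≤ min (EngineV8.klEngU₀3 P R cc) (1 / (R.Gfr 3 + 1)) →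
      ∀ β : ℝ, klBetaMin ≤ β → β ≤ Real.exp (cc / U ^ 2) →
      ∀ (L M : ℕ) [NeZero L] [NeZero M], EngineV8.klEngL₃ β U ≤ L → EngineV8.klEngM₃ β U L ≤ M →
      ∀ n : ℕ, 1 ≤ n → n ≤ nScales β + 1 →
        HistP klPredsV17F2 L M G P Q R β U μ 0 n → FrameOK R U (nScales β) μ (klFlowFrameU L M β U μ n) →
        ∀ (V : ℕ) [NeZero V], EngineV8.klEngL₃ β U ≤ V →
        ∀ d k J : ℕ, J + 1 ≤ d * k - 1 → d * k - 1 ≤ n → (4 : ℝ) ^ n * U ≤ (4 : ℝ) ^ (2 * (J + 1) + dd) → ∀ jr : ℕ, d * k - 1 ≤ jr →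
        (∀ x : SpaceTimeIdx V M × SectorLeg (sectorCount (d * k - 1)),
          ∑ y', ‖klJump V M β μ (klFlowFrameU L M β U μ n) (d * k - 1) J x y'‖ *
            klScaleWt V M β jr {latticeLegPos (2 * (2 * M)) x, latticeLegPos (2 * (2 * M)) y'} ≤ CJ * (2 : ℝ) ^ (d * k - 1 - J)) ∧
        (∀ y' : SpaceTimeIdx V M × SectorLeg (sectorCount J),
          ∑ x, ‖klJump V M β μ (klFlowFrameU L M β U μ n) (d * k - 1) J x y'‖ *
            klScaleWt V M β jr {latticeLegPos (2 * (2 * M)) x, latticeLegPos (2 * (2 * M)) y'} ≤ CJ * (2 : ℝ) ^ (d * k - 1 - J)) := by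
  obtain ⟨CJ, hCJ, h⟩ := klJump_scaleWtRows_klEng_deep_vol dd
  refine ⟨CJ, hCJ, ?_⟩
  intro G P R Q cc hR2 hcc hcc6 μ hμ U hU hUle β hβmin hβc L M _ _ hL3 hM3 n hn1 hnN hhist hfr V _ hV3 d k J hJ hkn hwin jr hjr
  exact h G P R Q cc hR2 hcc hcc6 μ hμ U hU hUle β hβmin hβc L M hL3 hM3 n hn1 hnN hhist hfr V hV3 J (d * k - 1) hJ hkn hwin jr hjr

end Summit.HubbardSuperconductivity.HubbardSuperconductivity.Theorems.TwoVolumeLip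

end
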